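import Mathlib.RingTheory.MvPolynomial.EulerIdentity
import Summits.MatrixMultiplication.MatrixMultiplication.Theorems.ObstructionCalculusLocality
import Summits.MatrixMultiplication.MatrixMultiplication.Theorems.ObstructionDescentCoordinateDegree
import Summits.MatrixMultiplication.MatrixMultiplication.Theorems.ObstructionDescentCoreWindow

set_option linter.dupNamespace false

/-!
# Obstruction descent — the GENERIC-RANK (Jacobian) engine (decomp-mm · lens 3 · gen 28, def-free)

`route-MatrixMultiplication-ObstructionDescent`, crux `NoOccurrenceObstruction` (`P_O`, stmt 29040); NODE-g28 §1.

The landed pointwise engines decide the saturation `HWV_{Λ,d} ∩ I(GL_m³·⟨m⟩) = HWV_{Λ,d} ⟹ HWV_{Λ,d} = 0` for types whose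
row supports `ℓ_s = #supp Λ⁽ˢ⁾` satisfy `ℓ_i·ℓ_j ≤ m` (`hwvSpace_eq_bot_of_slotPair`: every tensor of the sub-format has rank
`≤ m`) or `d ≤ m`.  This module lands the engine one level up: it suffices that the rank-`m` parametrisation
`[A|B|C] ↦ Σ_l A_{·l} ⊗ B_{·l} ⊗ C_{·l}` be DOMINANT on the coordinate subspace `ℂ^S ⊇` corner of `Λ`, i.e. that the
sub-format have GENERIC border rank `≤ m` (Terracini / Lickteig), and dominance is certified by ONE non-singular square
Jacobian minor at ONE rational point.

* §1 (pure algebra over `ℂ`, any index types).  Chain rule `∂_v(g∘Q) = Σ_k (∂_k g)∘Q · ∂_v Q_k` (`pderiv_aeval_eq_sum`);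
  JACOBIAN ANNIHILATION (`aeval_pderiv_eq_zero_of_jacobian`): if `g∘Q = 0`, `vars g ⊆ S` and some `S × S` minor
  `det(∂_{c(q)} Q_p)(e) ≠ 0`, then `(∂_k g)∘Q = 0` for every `k` (row vector times adjugate in the domain `ℂ[y]`);
  INJECTIVITY ON FORMS (`eq_zero_of_isHomogeneous_of_aeval_eq_zero`): a homogeneous `g` with `vars g ⊆ S` and `g∘Q = 0`
  is `0` (induction on the degree via Euler's identity `Σ x_k ∂_k g = d·g`, characteristic `0`).
* §2 (the calculus).  `f ∈ I(GL_m³·⟨m⟩) ⟹ f∘[A|B|C]_generic = 0` (`aeval_fromCols_genMat_eq_zero`, density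
  `evalT_fromCols_eq_zero_of_generic`); the variables of a weight vector of type `Λ` lie in the corner
  `{(a,b,c) : Λ⁽⁰⁾_a, Λ⁽¹⁾_b, Λ⁽²⁾_c ≠ 0}` (`corner_of_mem_vars_of_mem_hwvSpace`, from the weight law
  `sliceSum_eq_of_mem_support`); and the ENGINE `hwvSpace_eq_bot_of_jacobian`: a Jacobian certificate on a coordinate set
  `S ⊇ corner(Λ)` plus `HWV_{Λ,d} ≤ I(GL_m³·⟨m⟩)` force `HWV_{Λ,d} = ⊥` — for EVERY degree `d` and every kind of obstruction
  (occurrence, multiplicity, single vectors) carried by types inside that corner; pointwise form `eq_zero_of_jacobian`.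
* §3 (the cut, by name).  `noOccurrenceObstruction_of_uncertifiedCore`: the crux `P_O = NoOccurrenceObstruction` follows from
  the core clause of `noOccurrenceObstruction_of_core` (stub `UnitSaturationCore`) restricted to the UNCERTIFIED types —
  those whose corner admits no Jacobian certificate; the certified ones are discharged here (`core_of_uncertifiedCore`).

Reading (NODE-g28): a certificate for the box `T₀ × T₁ × T₂` exists iff `σ_m ⊇ ℂ^{T₀} ⊗ ℂ^{T₁} ⊗ ℂ^{T₂}`, i.e. iff the generic
border rank `r_g(#T₀,#T₁,#T₂) ≤ m`; so the window of the crux `UnitSaturationCore` shrinks from «`ℓ_iℓ_j > m`» to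
«`r_g(ℓ₀,ℓ₁,ℓ₂) > m`» (`r_g(a,b,c) ≈ abc/(a+b+c−2)`), e.g. at `n = 2`: no obligation in formats `(4,3,3)` (`r_g = 5`) for
`m ≥ 5`, nor in `(4,4,4)` (`r_g = 7`) for `m ≥ 7`.  No proposition is defined; no `def`; sorry-free; standard axioms.
[cite: LandsbergGCT2017, §2.1.6 (p. 33: Lickteig's generic border rank), §4.7.1 (p. 101: Terracini's lemma)]
[cite: BurgisserIkenmeyer2011, §3.1 (orbit closures, `S(t)`), Prop. 3.3] [cite: Lickteig1985] [cite: AboOttavianiPeterson2009]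
-/

noncomputable section

open scoped BigOperators
open Finset

namespace Summit.MatrixMultiplication.MatrixMultiplication.Theorems.ObstructionCalculus

open Literature.Computability.AlgebraicComplexity (unitTensor)

/-! ### §1 Chain rule, Jacobian annihilation, injectivity on forms -/

section Jacobian

variable {K V : Type*} [Fintype K] [DecidableEq K]

/-- **Chain rule** for partial derivatives of a substitution: `∂_v (g∘Q) = Σ_k (∂_k g)∘Q · ∂_v Q_k`. [folklore] -/
theorem pderiv_aeval_eq_sum (Q : K → MvPolynomial V ℂ) (v : V) (g : MvPolynomial K ℂ) :
    MvPolynomial.pderiv v (MvPolynomial.aeval Q g) =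
      ∑ k, MvPolynomial.aeval Q (MvPolynomial.pderiv k g) * MvPolynomial.pderiv v (Q k) := by
  classical
  induction g using MvPolynomial.induction_on with
  | C a =>
    simp only [MvPolynomial.algHom_C, MvPolynomial.algebraMap_eq, MvPolynomial.pderiv_C, map_zero, zero_mul,
      Finset.sum_const_zero]
  | add p q hp hq =>
    simp only [map_add, hp, hq, add_mul, Finset.sum_add_distrib]
  | mul_X p k hp =>
    have hX : ∀ k' : K, MvPolynomial.aeval Q (MvPolynomial.pderiv k' (MvPolynomial.X k : MvPolynomial K ℂ)) =
        if k = k' then 1 else 0 := by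
      intro k'
      rw [MvPolynomial.pderiv_X, Pi.single_apply]
      split_ifs <;> simp
    have hterm : ∀ k' : K, MvPolynomial.aeval Q (MvPolynomial.pderiv k' (p * MvPolynomial.X k)) *
        MvPolynomial.pderiv v (Q k') =
        MvPolynomial.aeval Q (MvPolynomial.pderiv k' p) * MvPolynomial.pderiv v (Q k') * Q k +
          (if k = k' then MvPolynomial.aeval Q p * MvPolynomial.pderiv v (Q k') else 0) := by
      intro k'
      rw [MvPolynomial.pderiv_mul, map_add, map_mul, map_mul, MvPolynomial.aeval_X, hX k']
      split_ifs <;> ring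
    rw [map_mul, MvPolynomial.aeval_X, MvPolynomial.pderiv_mul, hp, Finset.sum_congr rfl fun k' _ => hterm k',
      Finset.sum_add_distrib, Finset.sum_ite_eq, if_pos (Finset.mem_univ k), Finset.sum_mul]

omit [Fintype K] [DecidableEq K] in
/-- The variables of a partial derivative are among the variables of the polynomial. [bookkeeping] -/
theorem mem_vars_of_mem_vars_pderiv {g : MvPolynomial K ℂ} {k k' : K}
    (h : k' ∈ (MvPolynomial.pderiv k g).vars) : k' ∈ g.vars := by
  classical
  rw [MvPolynomial.mem_vars_iff_mem_support] at h ⊢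
  obtain ⟨μ, hμ, hk'⟩ := h
  refine ⟨μ + Finsupp.single k 1, ?_, ?_⟩
  · rw [MvPolynomial.mem_support_iff] at hμ ⊢
    rw [MvPolynomial.coeff_pderiv] at hμ
    exact left_ne_zero_of_mul hμ
  · rw [Finsupp.mem_support_iff] at hk' ⊢
    rw [Finsupp.add_apply]
    omega

/-- **Jacobian annihilation.**  Let `Q : K → ℂ[y]` be a substitution, `S` a set of variables and suppose some `S × S`
Jacobian minor `(∂_{c(q)} Q_p)_{p,q ∈ S}` is non-singular at a point `e`.  If `g ∈ ℂ[x_S]` (`vars g ⊆ S`) satisfies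
`g∘Q = 0`, then `(∂_k g)∘Q = 0` for every `k`: the row vector `w = ((∂_p g)∘Q)_p` satisfies `w·J = 0` by the chain rule,
hence `det(J)·w = w·J·adj(J) = 0` in the domain `ℂ[y]`, and `det J ≠ 0` since its value at `e` is not. [folklore] -/
theorem aeval_pderiv_eq_zero_of_jacobian (Q : K → MvPolynomial V ℂ) (S : Finset K) (c : S → V) (e : V → ℂ)
    (hdet : (Matrix.of fun p q : S => MvPolynomial.eval e (MvPolynomial.pderiv (c q) (Q p))).det ≠ 0)
    {g : MvPolynomial K ℂ} (hS : ∀ k ∈ g.vars, k ∈ S) (hg : MvPolynomial.aeval Q g = 0) (k : K) :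
    MvPolynomial.aeval Q (MvPolynomial.pderiv k g) = 0 := by
  classical
  by_cases hk : k ∈ S
  swap
  · rw [MvPolynomial.pderiv_eq_zero_of_notMem_vars (fun h => hk (hS k h)), map_zero]
  obtain ⟨M, hM⟩ : ∃ M : Matrix S S (MvPolynomial V ℂ),
      M = Matrix.of fun p q : S => MvPolynomial.pderiv (c q) (Q p) := ⟨_, rfl⟩
  obtain ⟨w, hw⟩ : ∃ w : S → MvPolynomial V ℂ,
      w = fun p : S => MvPolynomial.aeval Q (MvPolynomial.pderiv (p : K) g) := ⟨_, rfl⟩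
  -- the chain rule: `w · M = 0`
  have hwM : Matrix.vecMul w M = 0 := by
    funext q
    have h := pderiv_aeval_eq_sum Q (c q) g
    rw [hg, map_zero] at h
    have hsub : ∑ p ∈ S, MvPolynomial.aeval Q (MvPolynomial.pderiv p g) * MvPolynomial.pderiv (c q) (Q p) =
        ∑ p, MvPolynomial.aeval Q (MvPolynomial.pderiv p g) * MvPolynomial.pderiv (c q) (Q p) := by
      apply Finset.sum_subset (Finset.subset_univ S)
      intro p _ hp
      rw [MvPolynomial.pderiv_eq_zero_of_notMem_vars (fun h => hp (hS p h)), map_zero, zero_mul]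
    rw [Pi.zero_apply, Matrix.vecMul, dotProduct, hw, hM]
    simp only [Matrix.of_apply]
    rw [Finset.sum_coe_sort S (fun p : K =>
      MvPolynomial.aeval Q (MvPolynomial.pderiv p g) * MvPolynomial.pderiv (c q) (Q p)), hsub, ← h]
  -- `det M ≠ 0`: its value at `e` is the certified minor
  have hdetM : M.det ≠ 0 := by
    intro h0
    apply hdet
    have h1 := RingHom.map_det (MvPolynomial.eval e) M
    rw [h0, map_zero] at h1
    have hmat : (MvPolynomial.eval e).mapMatrix M =
        Matrix.of fun p q : S => MvPolynomial.eval e (MvPolynomial.pderiv (c q) (Q p)) := by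
      ext p q
      rw [RingHom.mapMatrix_apply, Matrix.map_apply, hM, Matrix.of_apply, Matrix.of_apply]
    rw [← hmat, ← h1]
  -- `det M · w = w · M · adj M = 0`
  have hw0 : M.det • w = 0 := by
    calc M.det • w = Matrix.vecMul w (M.det • (1 : Matrix S S (MvPolynomial V ℂ))) := by
          rw [Matrix.vecMul_smul, Matrix.vecMul_one]
      _ = Matrix.vecMul (Matrix.vecMul w M) M.adjugate := by rw [Matrix.vecMul_vecMul, Matrix.mul_adjugate]
      _ = 0 := by rw [hwM, Matrix.zero_vecMul]
  have hk0 := congr_fun hw0 ⟨k, hk⟩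
  rw [Pi.smul_apply, Pi.zero_apply, smul_eq_mul, hw] at hk0
  exact (mul_eq_zero.1 hk0).resolve_left hdetM

/-- **Jacobian criterion, injectivity on forms.**  Under a Jacobian certificate on `S` (some `S × S` minor of
`(∂_v Q_p)` non-singular at a rational point), the substitution `g ↦ g∘Q` is injective on HOMOGENEOUS polynomials in the
variables `S`: if `(∂_k g)∘Q = 0` for all `k` (Jacobian annihilation) then by induction on the degree every `∂_k g = 0`,
and Euler's identity `Σ_k x_k ∂_k g = d·g` gives `g = 0` in characteristic `0`. [folklore: Jacobian criterion] -/
theorem eq_zero_of_isHomogeneous_of_aeval_eq_zero (Q : K → MvPolynomial V ℂ) (S : Finset K) (c : S → V)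
    (e : V → ℂ) (hdet : (Matrix.of fun p q : S => MvPolynomial.eval e (MvPolynomial.pderiv (c q) (Q p))).det ≠ 0) :
    ∀ (d : ℕ) (g : MvPolynomial K ℂ), g.IsHomogeneous d → (∀ k ∈ g.vars, k ∈ S) →
      MvPolynomial.aeval Q g = 0 → g = 0 := by
  classical
  intro d
  induction d with
  | zero =>
    intro g hg _ h0
    rw [← MvPolynomial.totalDegree_zero_iff_isHomogeneous, MvPolynomial.totalDegree_eq_zero_iff_eq_C] at hg
    rw [hg, MvPolynomial.algHom_C, MvPolynomial.algebraMap_eq, MvPolynomial.C_eq_zero] at h0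
    rw [hg, h0, map_zero]
  | succ d ih =>
    intro g hg hS h0
    have hpd : ∀ k, MvPolynomial.pderiv k g = 0 := by
      intro k
      refine ih _ ?_ (fun k' hk' => hS k' (mem_vars_of_mem_vars_pderiv hk'))
        (aeval_pderiv_eq_zero_of_jacobian Q S c e hdet hS h0 k)
      have h := hg.pderiv (i := k)
      rwa [Nat.add_sub_cancel] at h
    have heuler := hg.sum_X_mul_pderiv
    simp only [hpd, mul_zero, Finset.sum_const_zero] at heuler
    have hmul : ((d + 1 : ℕ) : MvPolynomial K ℂ) * g = 0 := by
      rw [← nsmul_eq_mul]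
      exact heuler.symm
    exact (mul_eq_zero.1 hmul).resolve_left (Nat.cast_ne_zero.2 (Nat.succ_ne_zero d))

end Jacobian

/-! ### §2 The engine for weight vectors in the ideal of `GL_m³·⟨m⟩` -/

section Engine

variable {m : ℕ}

/-- **The rank-`m` parametrisation kills the ideal of `GL_m³·⟨m⟩`:** for `f ∈ I(GL_m³·⟨m⟩)` the pull-back
`f([A|B|C])` along the GENERIC matrices `A, B, C` (entries the `3m²` variables `MIdx m`) is the zero polynomial —
density of `GL_m³·⟨m⟩` in `Mat_m³·⟨m⟩ = {tensors of rank ≤ m}` (`evalT_fromCols_eq_zero_of_generic`) and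
`MvPolynomial.funext`. [cite: BurgisserIkenmeyer2011, §3.1] -/
theorem aeval_fromCols_genMat_eq_zero {f : MvPolynomial (Idx m) ℂ} (hf : f ∈ orbitVanishing (unitTensor ℂ m)) :
    MvPolynomial.aeval (fun p : Idx m => fromCols (genMat 0) (genMat 1) (genMat 2) p.1 p.2.1 p.2.2) f = 0 := by
  classical
  have hgen : ∀ A B C : Matrix (Fin m) (Fin m) ℂ, evalT (fromCols A B C) f = 0 := by
    refine evalT_fromCols_eq_zero_of_generic f (fun A B C hA hB hC => ?_)
    have h' := hf A B C hA hB hC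
    rwa [actTensor_unitTensor] at h'
  apply MvPolynomial.funext
  intro e
  rw [map_zero]
  change MvPolynomial.aeval e (MvPolynomial.bind₁
    (fun p : Idx m => fromCols (genMat 0) (genMat 1) (genMat 2) p.1 p.2.1 p.2.2) f) = 0
  have hfun : (fun p : Idx m => MvPolynomial.aeval e (fromCols (genMat 0) (genMat 1) (genMat 2) p.1 p.2.1 p.2.2)) =
      fun p : Idx m => fromCols (matOf e 0) (matOf e 1) (matOf e 2) p.1 p.2.1 p.2.2 :=
    funext fun p => aeval_fromCols_genMat e p.1 p.2.1 p.2.2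
  rw [MvPolynomial.aeval_bind₁, hfun]
  exact hgen _ _ _

/-- **Support locality of weight vectors:** every variable `x_{abc}` of a weight vector of type `Λ` lies in the CORNER of
`Λ`: `Λ⁽⁰⁾_a ≠ 0`, `Λ⁽¹⁾_b ≠ 0`, `Λ⁽²⁾_c ≠ 0` (the weight law: the slice marginals of every monomial are `Λ`).
[cite: BurgisserIkenmeyer2011, §3.1] -/
theorem corner_of_mem_vars_of_mem_hwvSpace {Λ : Fin 3 → Fin m → ℕ} {d : ℕ} {f : MvPolynomial (Idx m) ℂ}
    (hf : f ∈ hwvSpace Λ d) {p : Idx m} (hp : p ∈ f.vars) :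
    Λ 0 p.1 ≠ 0 ∧ Λ 1 p.2.1 ≠ 0 ∧ Λ 2 p.2.2 ≠ 0 := by
  classical
  rw [MvPolynomial.mem_vars_iff_mem_support] at hp
  obtain ⟨μ, hμ, hpμ⟩ := hp
  have hμp : 0 < μ p := Nat.pos_of_ne_zero (Finsupp.mem_support_iff.1 hpμ)
  have hsl := sliceSum_eq_of_mem_support hf hμ
  have key : ∀ (P : Idx m → Prop) [DecidablePred P], P p →
      μ p ≤ ∑ q ∈ μ.support.filter (fun q => P q), μ q := by
    intro P _ hP
    exact Finset.single_le_sum (f := fun q => μ q) (fun q _ => Nat.zero_le _)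
      (Finset.mem_filter.2 ⟨hpμ, hP⟩)
  refine ⟨?_, ?_, ?_⟩
  · have h := key (fun q => q.1 = p.1) rfl
    rw [(hsl p.1).1] at h
    omega
  · have h := key (fun q => q.2.1 = p.2.1) rfl
    rw [(hsl p.2.1).2.1] at h
    omega
  · have h := key (fun q => q.2.2 = p.2.2) rfl
    rw [(hsl p.2.2).2.2] at h
    omega

/-- **The generic-rank (Jacobian) engine, pointwise form.**  Let `S` be a set of coordinates containing the corner of the
type `Λ`, and suppose the rank-`m` parametrisation `[A|B|C]` has a non-singular `S × S` Jacobian minor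
`(∂ [A|B|C]_p / ∂ y_{c(q)})_{p,q ∈ S}` at some rational point `e` («`σ_m` fills the coordinate subspace `ℂ^S`», e.g. the
sub-format spanned by the corner has generic border rank `≤ m`).  Then every weight vector of type `Λ` vanishing on
`GL_m³·⟨m⟩` is ZERO. [cite: LandsbergGCT2017, §4.7.1 (p. 101), §2.1.6 (p. 33)] [cite: BurgisserIkenmeyer2011, §3.1] -/
theorem eq_zero_of_jacobian {Λ : Fin 3 → Fin m → ℕ} {d : ℕ} (S : Finset (Idx m))
    (hS : ∀ p : Idx m, Λ 0 p.1 ≠ 0 → Λ 1 p.2.1 ≠ 0 → Λ 2 p.2.2 ≠ 0 → p ∈ S)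
    (c : S → MIdx m) (e : MIdx m → ℂ)
    (hdet : (Matrix.of fun p q : S => MvPolynomial.eval e (MvPolynomial.pderiv (c q)
      (fromCols (genMat 0) (genMat 1) (genMat 2) (p : Idx m).1 (p : Idx m).2.1 (p : Idx m).2.2))).det ≠ 0)
    {f : MvPolynomial (Idx m) ℂ} (hf : f ∈ hwvSpace Λ d) (hU : f ∈ orbitVanishing (unitTensor ℂ m)) : f = 0 := by
  classical
  refine eq_zero_of_isHomogeneous_of_aeval_eq_zero
    (fun p : Idx m => fromCols (genMat 0) (genMat 1) (genMat 2) p.1 p.2.1 p.2.2) S c e hdet d f hf.1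
    (fun p hp => ?_) (aeval_fromCols_genMat_eq_zero hU)
  obtain ⟨h0, h1, h2⟩ := corner_of_mem_vars_of_mem_hwvSpace hf hp
  exact hS p h0 h1 h2

/-- **The generic-rank (Jacobian) engine** (third pointwise engine of the calculus, after `hwvSpace_eq_bot_of_slotPair` and
`hwvSpace_eq_bot_of_degree_le`): under a Jacobian certificate on a coordinate set `S ⊇ corner(Λ)`, if EVERY weight vector
of type `Λ` and degree `d` vanishes on `GL_m³·⟨m⟩` then there is none — `HWV_{Λ,d} = 0`; in particular such a type carries
no occurrence obstruction against any `s ∈ Mat_m³·⟨m⟩` (e.g. `pad_m⟨n,n,n⟩`) in any degree.  The certificate exists iff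
the generic border rank of the box spanned by `S` is `≤ m`, which strictly contains the slot-pair regime `ℓ_iℓ_j ≤ m`.
[cite: LandsbergGCT2017, §2.1.6 (p. 33), §4.7.1 (p. 101)] [cite: BurgisserIkenmeyer2011, §3.1, Prop. 3.3] -/
theorem hwvSpace_eq_bot_of_jacobian {Λ : Fin 3 → Fin m → ℕ} {d : ℕ} (S : Finset (Idx m))
    (hS : ∀ p : Idx m, Λ 0 p.1 ≠ 0 → Λ 1 p.2.1 ≠ 0 → Λ 2 p.2.2 ≠ 0 → p ∈ S)
    (c : S → MIdx m) (e : MIdx m → ℂ)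
    (hdet : (Matrix.of fun p q : S => MvPolynomial.eval e (MvPolynomial.pderiv (c q)
      (fromCols (genMat 0) (genMat 1) (genMat 2) (p : Idx m).1 (p : Idx m).2.1 (p : Idx m).2.2))).det ≠ 0)
    (hU : hwvSpace Λ d ≤ orbitVanishing (unitTensor ℂ m)) : hwvSpace Λ d = ⊥ := by
  rw [Submodule.eq_bot_iff]
  intro f hf
  exact eq_zero_of_jacobian S hS c e hdet hf (hU hf)

/-- **Occurrence form of the engine:** under a Jacobian certificate on `S ⊇ corner(Λ)`, a type that does not occur for
`⟨m⟩` in degree `d` does not occur for ANY tensor `s` of format `m` in degree `d` — vacuously, since `HWV_{Λ,d} = 0`; so no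
occurrence (or multiplicity) obstruction of type `Λ` exists in the certified sub-formats. [cite: BurgisserIkenmeyer2011, Prop. 3.3] -/
theorem hwvSpace_le_orbitVanishing_of_jacobian {Λ : Fin 3 → Fin m → ℕ} {d : ℕ} (S : Finset (Idx m))
    (hS : ∀ p : Idx m, Λ 0 p.1 ≠ 0 → Λ 1 p.2.1 ≠ 0 → Λ 2 p.2.2 ≠ 0 → p ∈ S)
    (c : S → MIdx m) (e : MIdx m → ℂ)
    (hdet : (Matrix.of fun p q : S => MvPolynomial.eval e (MvPolynomial.pderiv (c q)
      (fromCols (genMat 0) (genMat 1) (genMat 2) (p : Idx m).1 (p : Idx m).2.1 (p : Idx m).2.2))).det ≠ 0)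
    (hU : hwvSpace Λ d ≤ orbitVanishing (unitTensor ℂ m)) (s : Tensor ℂ m) :
    hwvSpace Λ d ≤ orbitVanishing s := by
  rw [hwvSpace_eq_bot_of_jacobian S hS c e hdet hU]
  exact bot_le

end Engine

end Summit.MatrixMultiplication.MatrixMultiplication.Theorems.ObstructionCalculus

/-! ### §3 The cut of NODE-g28: `P_O` follows from the core clause on UNCERTIFIED types only -/

namespace Summit.MatrixMultiplication.MatrixMultiplication.Theorems.ObstructionDescentGenericRankEngine

open Literature.Computability.AlgebraicComplexity (unitTensor)
open Summit.MatrixMultiplication.MatrixMultiplication.Theorems.ObstructionCalculus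
open Summit.MatrixMultiplication.MatrixMultiplication.Theses.ObstructionDescent
open Summit.MatrixMultiplication.MatrixMultiplication.Theorems.ObstructionDescentCoreWindow

/-- **The core window shrinks to the uncertified types.**  The hypothesis of `unitSaturation_of_core` /
`noOccurrenceObstruction_of_core` (the registered stub `UnitSaturationCore` of crux 29040: saturation for types in the window
`2 < τ < 4`, `d > m`, `≤ n²` parts per slot, `> m` part-pairs per slot pair) follows from the SAME clause restricted to types
whose corner admits NO Jacobian certificate (no coordinate set `S ⊇ corner(Λ)`, pivot choice `c` and point `e` with a
non-singular minor) — the certified types are discharged by the engine `hwvSpace_eq_bot_of_jacobian`. [this node] -/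
theorem core_of_uncertifiedCore
    (h : ∀ τ : ℝ, 2 < τ → τ < 4 → ∃ n₀ : ℕ, ∀ n m : ℕ, n₀ ≤ n → n * n ≤ m → (n : ℝ) ^ τ ≤ (m : ℝ) →
      ∀ (Λ : Fin 3 → Fin m → ℕ) (d : ℕ), m < d → (∀ s, (Finset.univ.filter fun a => Λ s a ≠ 0).card ≤ n * n) →
        m < (Finset.univ.filter fun a => Λ 0 a ≠ 0).card * (Finset.univ.filter fun a => Λ 1 a ≠ 0).card →
        m < (Finset.univ.filter fun a => Λ 0 a ≠ 0).card * (Finset.univ.filter fun a => Λ 2 a ≠ 0).card →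
        m < (Finset.univ.filter fun a => Λ 1 a ≠ 0).card * (Finset.univ.filter fun a => Λ 2 a ≠ 0).card →
        (∀ S : Finset (Idx m), (∀ p : Idx m, Λ 0 p.1 ≠ 0 → Λ 1 p.2.1 ≠ 0 → Λ 2 p.2.2 ≠ 0 → p ∈ S) →
          ∀ (c : S → MIdx m) (e : MIdx m → ℂ),
            (Matrix.of fun p q : S => MvPolynomial.eval e (MvPolynomial.pderiv (c q)
              (fromCols (genMat 0) (genMat 1) (genMat 2) (p : Idx m).1 (p : Idx m).2.1 (p : Idx m).2.2))).det = 0) →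
          hwvSpace Λ d ≤ orbitVanishing (unitTensor ℂ m) → hwvSpace Λ d = ⊥) :
    ∀ τ : ℝ, 2 < τ → τ < 4 → ∃ n₀ : ℕ, ∀ n m : ℕ, n₀ ≤ n → n * n ≤ m → (n : ℝ) ^ τ ≤ (m : ℝ) →
      ∀ (Λ : Fin 3 → Fin m → ℕ) (d : ℕ), m < d → (∀ s, (Finset.univ.filter fun a => Λ s a ≠ 0).card ≤ n * n) →
        m < (Finset.univ.filter fun a => Λ 0 a ≠ 0).card * (Finset.univ.filter fun a => Λ 1 a ≠ 0).card →
        m < (Finset.univ.filter fun a => Λ 0 a ≠ 0).card * (Finset.univ.filter fun a => Λ 2 a ≠ 0).card →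
        m < (Finset.univ.filter fun a => Λ 1 a ≠ 0).card * (Finset.univ.filter fun a => Λ 2 a ≠ 0).card →
          hwvSpace Λ d ≤ orbitVanishing (unitTensor ℂ m) → hwvSpace Λ d = ⊥ := by
  intro τ hτ hτ4
  obtain ⟨n₀, hn₀⟩ := h τ hτ hτ4
  refine ⟨n₀, fun n m hn hnm hτm Λ d hd hparts h01 h02 h12 hU => ?_⟩
  by_cases hcert : ∃ S : Finset (Idx m), (∀ p : Idx m, Λ 0 p.1 ≠ 0 → Λ 1 p.2.1 ≠ 0 → Λ 2 p.2.2 ≠ 0 → p ∈ S) ∧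
      ∃ (c : S → MIdx m) (e : MIdx m → ℂ),
        (Matrix.of fun p q : S => MvPolynomial.eval e (MvPolynomial.pderiv (c q)
          (fromCols (genMat 0) (genMat 1) (genMat 2) (p : Idx m).1 (p : Idx m).2.1 (p : Idx m).2.2))).det ≠ 0
  · obtain ⟨S, hS, c, e, hdet⟩ := hcert
    exact hwvSpace_eq_bot_of_jacobian S hS c e hdet hU
  · refine hn₀ n m hn hnm hτm Λ d hd hparts h01 h02 h12 (fun S hS c e => ?_) hU
    by_contra hne
    exact hcert ⟨S, hS, c, e, hne⟩

/-- **The cut of NODE-g28, by name:** `UncertifiedCore ⟹ NoOccurrenceObstruction` — the occurrence crux `P_O` (stmt 29040)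
follows from unit saturation for the UNCERTIFIED types of the core window alone (types whose corner box is not filled by
`σ_m`, i.e. of generic border rank `> m`: all three slots fat); every other instance is a landed theorem (pad inheritance,
engines 1–3, the rung `τ ≥ 4`). [this node] -/
theorem noOccurrenceObstruction_of_uncertifiedCore
    (h : ∀ τ : ℝ, 2 < τ → τ < 4 → ∃ n₀ : ℕ, ∀ n m : ℕ, n₀ ≤ n → n * n ≤ m → (n : ℝ) ^ τ ≤ (m : ℝ) →
      ∀ (Λ : Fin 3 → Fin m → ℕ) (d : ℕ), m < d → (∀ s, (Finset.univ.filter fun a => Λ s a ≠ 0).card ≤ n * n) →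
        m < (Finset.univ.filter fun a => Λ 0 a ≠ 0).card * (Finset.univ.filter fun a => Λ 1 a ≠ 0).card →
        m < (Finset.univ.filter fun a => Λ 0 a ≠ 0).card * (Finset.univ.filter fun a => Λ 2 a ≠ 0).card →
        m < (Finset.univ.filter fun a => Λ 1 a ≠ 0).card * (Finset.univ.filter fun a => Λ 2 a ≠ 0).card →
        (∀ S : Finset (Idx m), (∀ p : Idx m, Λ 0 p.1 ≠ 0 → Λ 1 p.2.1 ≠ 0 → Λ 2 p.2.2 ≠ 0 → p ∈ S) →
          ∀ (c : S → MIdx m) (e : MIdx m → ℂ),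
            (Matrix.of fun p q : S => MvPolynomial.eval e (MvPolynomial.pderiv (c q)
              (fromCols (genMat 0) (genMat 1) (genMat 2) (p : Idx m).1 (p : Idx m).2.1 (p : Idx m).2.2))).det = 0) →
          hwvSpace Λ d ≤ orbitVanishing (unitTensor ℂ m) → hwvSpace Λ d = ⊥) :
    NoOccurrenceObstruction :=
  noOccurrenceObstruction_of_core (core_of_uncertifiedCore h)

end Summit.MatrixMultiplication.MatrixMultiplication.Theorems.ObstructionDescentGenericRankEngine
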